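import Summits.Ventures.CertifiedQuantumChemistry.Rows.CIUpperBound
import Literature.MathematicalPhysics.QuantumChemistry.CharacterSectorRayleighRitz
import HarnessLib

/-!
# Ventures/CertifiedQuantumChemistry — Rows/CharacterSectorRows.lean: POINT-GROUP-RESOLVED sector rows (abelian sign characters) and their certificates

HONEST FRAMING (verbatim): certified bounds for a stated model Hamiltonian in a stated basis; not a
claim about the real molecule beyond that model.

LADDER-CHEM I-TYPE (cell chem-oracle, seat chem-type-06, offer (G), 2026-08-26; zero compute; PROVED glue
only, 0 sorry, no claim node; nothing here asserts a bound about any model). SIBLING of `Rows/SectorRows.lean`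
(`LowerRow` / `UpperRow` on the `(N_α, N_β) = (a, b)` sector energy `Model.energy`) and `Rows/SingletRows.lean`
(the `S = 0` sub-sector), for the next sub-sector the validation set asks for (bench `§CO2` CO2-139:
`HC(O)O•` `²B₂ − ²A₁`, an IRREP pair inside one `M_S` sector; CO2-128…132): the SYMMETRY CLASS of an abelian
point group. With symmetry-adapted orbitals (FCIDUMP `ORBSYM`, Knowles–Handy 1989) every occupation-number
vector carries a sign character, so the class `(σ, p)` — parities `#(s ∩ σ i) ≡ p i (mod 2)` of the
occupied spin-orbitals inside the generator sets `σ i` — is a COORDINATE sub-sector spanned by determinants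
(`Literature/…/CharacterSectorRayleighRitz.lean`: `charSector`, `charSectorGroundEnergy`).

* `Model.charEnergy F a b σ p` — the class-resolved sector energy `E(H_F; a, b, class)` (DEFINITION over the
  Literature object); `IsCharDet σ p s` — the decidable class test of a determinant;
* `CharLowerRow F a b σ p lo` / `CharUpperRow F a b σ p hi` — row predicates: the class is INHABITED in the
  sector (an explicit determinant; replaces the range `a, b ≤ k` of the plain rows, which it implies) and
  `lo ≤ E(class)` / `E(class) ≤ hi` (DEFINITIONS; nothing asserted);
* soundness of UPPER rows — Rayleigh–Ritz in the class (Helgaker–Jørgensen–Olsen (2000) §4.2.4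
  (4.2.37)–(4.2.38), p. 115, "the lowest eigenvalue in `S′` represents an upper bound to the lowest
  eigenvalue in `S″`", `S″` = the determinants of the class): `CIVec.charUpperRow` — an exact-`ℚ` CI record
  whose determinants are sector-pure AND of the class, `0 < normSq`, `energy ≤ hi · normSq` ⇒
  `CharUpperRow F a b σ p hi` (three decidable facts + the kernel inequality, as for `CIVec.upperRow`);
* what LOWER rows exist: `LowerRow.charLowerRow` — every plain sector lower row floors every inhabited class
  (`E₀(a, b) ≤ E(class)`); NO class-specific lower certificate is typed (a two-electron reduced-density-matrix
  relaxation cannot see the class of an abelian group — Mazziotti (2007) §II.F; honest consequence below);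
* readings: `CharUpperRow.upperRow_of_ground` is NOT claimed (a class upper row bounds the sector energy
  only if the class contains the ground state); instead `Model.energy_le_charEnergy` (`E₀ ≤ E(class)`) and
  the ONE-SIDED class-gap bracket `CharUpperRow.gap_le` : `CharUpperRow … hi → LowerRow F a b lo →
  E(class) − E₀(a, b) ≤ hi − lo` (with `0 ≤ E(class) − E₀`), which is how CO2-139-type rows are certified
  today; `Model.isLeast_charEnergy_eigenvalue` — for a model whose Hamiltonian commutes with the character
  operators (integral selection rules; `orbitalSignOp_commute_molecularHamiltonian`) `E(class)` is the least
  eigenvalue of `H_F` of that symmetry in the sector.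

WHAT THIS IS NOT: no two-sided class-gap certificate (the lower side of an excited class needs an
excited-state instrument — Temple with a certified gap leg, `Rows/CISecondMoment.lean`, or a symmetry the
RDMs can see); non-abelian groups not treated; the generator sets `σ i` are data the row carries (for spatial
symmetry: both spin-orbitals of the orbitals with character `−1` under the `i`-th generator) — reading them
off `ORBSYM` is reader-side, like every model-file fact; no number is certified here.
-/

namespace Summit.Ventures.CertifiedQuantumChemistry

open Matrix Finset
open Literature.MathematicalPhysics.QuantumLattice Literature.MathematicalPhysics.QuantumChemistry
open Literature.MathematicalPhysics.QuantumLattice.EigenvalueContinuation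

variable {k m : ℕ}

/-! ## The class test of a determinant and the class-resolved energy -/

/-- **Class test of a determinant**: `s` belongs to the symmetry class `(σ, p)` iff
`#(s ∩ σ i) ≡ p i (mod 2)` for every generator `i` (an `abbrev`, so `decide` closes it on literal data — no
`instance` is declared; for `ORBSYM`-labelled orbitals: the parity of the number of occupied spin-orbitals of
character `−1`). [cite: Mazziotti2007RDMChapter, §II.F eq. (95)] -/
abbrev IsCharDet (σ : Fin m → Finset (Orb (Fin k))) (p : Fin m → ℕ) (s : Finset (Orb (Fin k))) : Prop :=
  ∀ i, (s ∩ σ i).card % 2 = p i % 2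

namespace Model

/-- **The class-resolved sector energy** `E(H_F; a, b, class (σ, p))`: the lowest energy of the model
Hamiltonian among states of the `(a, b)` sector supported on determinants of the class
(`charSectorGroundEnergy`, `Literature/…/CharacterSectorRayleighRitz.lean`). JUNK VALUE `0` when the class is not
inhabited in the sector; rows carry an inhabitant. Helgaker–Jørgensen–Olsen (2000) §4.2.4, p. 115 ("the five
lowest `¹Σ⁺` electronic energies of the BH molecule" are such class energies). [cite: HelgakerJorgensenOlsen2000, eq. (4.2.38), p. 115] -/
noncomputable def charEnergy (F : Model k) (a b : ℕ) (σ : Fin m → Finset (Orb (Fin k))) (p : Fin m → ℕ) : ℝ :=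
  charSectorGroundEnergy F.hamiltonian a b σ p

/-- Unfolding: `charEnergy` is the Literature `charSectorGroundEnergy` of `H_F`. -/
theorem charEnergy_def (F : Model k) (a b : ℕ) (σ : Fin m → Finset (Orb (Fin k))) (p : Fin m → ℕ) :
    F.charEnergy a b σ p = charSectorGroundEnergy F.hamiltonian a b σ p :=
  rfl

/-- **The sector energy floors every inhabited class**: for a symmetric model and a determinant `s` of the
`(a, b)` sector in the class, `Model.energy F a b ≤ Model.charEnergy F a b σ p`.
[cite: HelgakerJorgensenOlsen2000, eq. (4.2.38), p. 115] -/
theorem energy_le_charEnergy {F : Model k} (hF : F.IsSymmetric) {a b : ℕ} {σ : Fin m → Finset (Orb (Fin k))}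
    {p : Fin m → ℕ} {s : Finset (Orb (Fin k))} (ha : (upPart s).card = a) (hb : (downPart s).card = b)
    (hs : IsCharDet σ p s) : F.energy a b ≤ F.charEnergy a b σ p :=
  sectorGroundEnergy_le_charSectorGroundEnergy σ p (Model.hamiltonian_isHermitian hF) ha hb hs

/-- **`E(class)` is an eigenvalue** — the least eigenvalue of `H_F` with an eigenvector of the class in the
`(a, b)` sector — whenever `H_F` commutes with the character operators `U_{σ i}` (integral selection rules of
the point group, `orbitalSignOp_commute_molecularHamiltonian`) and the class is inhabited. Horn–Johnson
Thm 4.2.2, p. 234; Helgaker–Jørgensen–Olsen (2000) §4.2.4, p. 115. [cite: HornJohnson2013, Thm 4.2.2, p. 234] -/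
theorem isLeast_charEnergy_eigenvalue {F : Model k} (hF : F.IsSymmetric) {σ : Fin m → Finset (Orb (Fin k))}
    {p : Fin m → ℕ} (hU : ∀ i, Commute F.hamiltonian (orbitalSignOp (σ i))) {a b : ℕ}
    {s : Finset (Orb (Fin k))} (ha : (upPart s).card = a) (hb : (downPart s).card = b) (hs : IsCharDet σ p s) :
    IsLeast {e : ℝ | ∃ ψ : Fock (Orb (Fin k)), IsInSector a b ψ ∧ ψ ∈ charSector σ p ∧ ψ ≠ 0 ∧
        F.hamiltonian *ᵥ ψ = (e : ℂ) • ψ} (F.charEnergy a b σ p) :=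
  isLeast_charSectorGroundEnergy_eigenvalue_of_commute σ p (Model.hamiltonian_isHermitian hF)
    (molecularHamiltonian_commute_totalNumber _ _ _) (molecularHamiltonian_commute_spinZ _ _ _) hU ha hb hs

end Model

/-! ## Row predicates (explicit rational slots; the inhabitant is part of the row; nothing asserted) -/

/-- CLASS LOWER row: the class `(σ, p)` is inhabited in the `(a, b)` sector (explicit determinant) and the
rational `lo` is a lower bound of the class energy, `(lo : ℝ) ≤ E(H_F; a, b, class)`. -/
def CharLowerRow (F : Model k) (a b : ℕ) (σ : Fin m → Finset (Orb (Fin k))) (p : Fin m → ℕ) (lo : ℚ) : Prop :=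
  (∃ s : Finset (Orb (Fin k)), (upPart s).card = a ∧ (downPart s).card = b ∧ IsCharDet σ p s) ∧
    ((lo : ℚ) : ℝ) ≤ F.charEnergy a b σ p

/-- CLASS UPPER row: the class is inhabited in the sector and `E(H_F; a, b, class) ≤ (hi : ℝ)`. -/
def CharUpperRow (F : Model k) (a b : ℕ) (σ : Fin m → Finset (Orb (Fin k))) (p : Fin m → ℕ) (hi : ℚ) : Prop :=
  (∃ s : Finset (Orb (Fin k)), (upPart s).card = a ∧ (downPart s).card = b ∧ IsCharDet σ p s) ∧
    F.charEnergy a b σ p ≤ ((hi : ℚ) : ℝ)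

variable {F : Model k} {a b : ℕ} {σ : Fin m → Finset (Orb (Fin k))} {p : Fin m → ℕ}

/-- A determinant with `a` up and `b` down electrons among `k` orbitals forces `a, b ≤ k`. -/
private theorem range_of_det {s : Finset (Orb (Fin k))} (ha : (upPart s).card = a) (hb : (downPart s).card = b) :
    a ≤ k ∧ b ≤ k :=
  ⟨ha ▸ (Finset.card_le_univ _).trans_eq (Fintype.card_fin k),
    hb ▸ (Finset.card_le_univ _).trans_eq (Fintype.card_fin k)⟩

/-- A class row lives on the physical range `a ≤ k ∧ b ≤ k`. -/
theorem CharLowerRow.range {lo : ℚ} (h : CharLowerRow F a b σ p lo) : a ≤ k ∧ b ≤ k := by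
  obtain ⟨⟨s, ha, hb, -⟩, -⟩ := h
  exact range_of_det ha hb

/-- A class row lives on the physical range `a ≤ k ∧ b ≤ k`. -/
theorem CharUpperRow.range {hi : ℚ} (h : CharUpperRow F a b σ p hi) : a ≤ k ∧ b ≤ k := by
  obtain ⟨⟨s, ha, hb, -⟩, -⟩ := h
  exact range_of_det ha hb

/-- The inequality carried by a class lower row. -/
theorem CharLowerRow.le {lo : ℚ} (h : CharLowerRow F a b σ p lo) : ((lo : ℚ) : ℝ) ≤ F.charEnergy a b σ p :=
  h.2

/-- The inequality carried by a class upper row. -/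
theorem CharUpperRow.le {hi : ℚ} (h : CharUpperRow F a b σ p hi) : F.charEnergy a b σ p ≤ ((hi : ℚ) : ℝ) :=
  h.2

/-- The width of a two-sided class bracket is nonnegative: `lo ≤ hi`. -/
theorem CharLowerRow.le_of_charUpperRow {lo hi : ℚ} (hL : CharLowerRow F a b σ p lo)
    (hU : CharUpperRow F a b σ p hi) : lo ≤ hi := by
  exact_mod_cast hL.le.trans hU.le

/-! ## Soundness: what certifies a class row -/

/-- **Every sector LOWER row is a class lower row** for every inhabited class (`E₀(a, b) ≤ E(class)`): the
certified SDP lower bounds of the ladder floor all symmetry classes at once. Helgaker–Jørgensen–Olsen (2000)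
(4.2.38), p. 115. [cite: HelgakerJorgensenOlsen2000, eq. (4.2.38), p. 115] -/
theorem LowerRow.charLowerRow (hF : F.IsSymmetric) {lo : ℚ} (h : LowerRow F a b lo) {s : Finset (Orb (Fin k))}
    (ha : (upPart s).card = a) (hb : (downPart s).card = b) (hs : IsCharDet σ p s) :
    CharLowerRow F a b σ p lo :=
  ⟨⟨s, ha, hb, hs⟩, h.le.trans (Model.energy_le_charEnergy hF ha hb hs)⟩

/-- **CLASS UPPER CERTIFICATE predicate**: an explicit NONZERO vector supported on the `(a, b)` sector AND on
the class `(σ, p)` whose exact Rayleigh data satisfy `Re ⟨ψ, H_F ψ⟩ ≤ hi · ⟨ψ, ψ⟩` (same shape as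
`UpperCertificate`, one more support condition). -/
def CharUpperCertificate (F : Model k) (a b : ℕ) (σ : Fin m → Finset (Orb (Fin k))) (p : Fin m → ℕ)
    (hi : ℚ) : Prop :=
  ∃ ψ : Fock (Orb (Fin k)), IsInSector a b ψ ∧ ψ ∈ charSector σ p ∧ ψ ≠ 0 ∧
    (star ψ ⬝ᵥ F.hamiltonian *ᵥ ψ).re ≤ ((hi : ℚ) : ℝ) * (star ψ ⬝ᵥ ψ).re

/-- A nonzero vector supported on sector and class exhibits an inhabitant determinant of the class in the
sector (some coordinate `ψ s ≠ 0`; the support conditions put `s` in the sector and the class). -/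
theorem exists_det_of_mem {ψ : Fock (Orb (Fin k))} (hψ : IsInSector a b ψ) (hχ : ψ ∈ charSector σ p)
    (h0 : ψ ≠ 0) : ∃ s : Finset (Orb (Fin k)), (upPart s).card = a ∧ (downPart s).card = b ∧ IsCharDet σ p s := by
  obtain ⟨s, hs⟩ := Function.ne_iff.1 h0
  refine ⟨s, ?_, ?_, fun i => ?_⟩
  · by_contra h; exact hs (hψ s fun hab => h hab.1)
  · by_contra h; exact hs (hψ s fun hab => h hab.2)
  · by_contra h; exact hs ((mem_charSector_iff σ p ψ).1 hχ s ⟨i, h⟩)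

/-- **SOUNDNESS OF CLASS UPPER ROWS.** Rayleigh–Ritz in the class: `CharUpperCertificate → CharUpperRow` for a
symmetric model (the witness supplies the inhabitant). Helgaker–Jørgensen–Olsen (2000) (4.2.37)–(4.2.38),
p. 115; Horn–Johnson Thm 4.2.2, p. 234. [cite: HelgakerJorgensenOlsen2000, eq. (4.2.38), p. 115] -/
theorem charUpperRow_of_certificate (hF : F.IsSymmetric) {hi : ℚ} (h : CharUpperCertificate F a b σ p hi) :
    CharUpperRow F a b σ p hi := by
  obtain ⟨ψ, hψ, hχ, h0, hu⟩ := h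
  exact ⟨exists_det_of_mem hψ hχ h0,
    charSectorGroundEnergy_le_of_rayleigh σ p (Model.hamiltonian_isHermitian hF) hψ hχ h0 hu⟩

namespace CIVec

variable {n : ℕ}

/-- All determinants of the record belong to the class `(σ, p)` (an `abbrev`: `decide` closes it on literal
records). -/
abbrev InClass (ψ : CIVec k n) (σ : Fin m → Finset (Orb (Fin k))) (p : Fin m → ℕ) : Prop :=
  ∀ i, IsCharDet σ p (ψ.det i)

/-- Class-pure determinants give a class-pure trial vector. [cite: Mazziotti2007RDMChapter, §II.F eq. (95)] -/
theorem vec_mem_charSector {ψ : CIVec k n} (h : ψ.InClass σ p) : ψ.vec ∈ charSector σ p := by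
  unfold vec
  refine Submodule.sum_mem _ fun i _ => Submodule.smul_mem _ _ (single_mem_charSector σ p (h i) 1)

/-- **KERNEL ENTRY POINT FOR CLASS UPPER CERTIFICATES.** Sector-pure AND class-pure determinants, positive norm
and `energy ≤ hi · normSq` (four decidable facts) give `CharUpperCertificate F a b σ p hi`.
[cite: HelgakerJorgensenOlsen2000, eq. (4.2.38), p. 115] -/
theorem charUpperCertificate (F : Model k) (ψ : CIVec k n) {hi : ℚ} (hsec : ψ.InSector a b)
    (hcl : ψ.InClass σ p) (hpos : 0 < ψ.normSq) (hle : ψ.energy F ≤ hi * ψ.normSq) :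
    CharUpperCertificate F a b σ p hi := by
  refine ⟨ψ.vec, isInSector_vec hsec, vec_mem_charSector hcl, vec_ne_zero_of_normSq_pos hpos, ?_⟩
  rw [star_vec_dotProduct_hamiltonian_mulVec, star_vec_dotProduct_vec, Complex.ratCast_re, Complex.ratCast_re]
  exact_mod_cast hle

/-- **Kernel-proved CLASS upper row** from an exact-`ℚ` CI record of the class (Rayleigh–Ritz in the class,
`charUpperRow_of_certificate`): the symmetry-resolved analogue of `CIVec.upperRow`.
[cite: HelgakerJorgensenOlsen2000, eq. (4.2.38), p. 115] -/
theorem charUpperRow {F : Model k} (hF : F.IsSymmetric) (ψ : CIVec k n) {hi : ℚ} (hsec : ψ.InSector a b)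
    (hcl : ψ.InClass σ p) (hpos : 0 < ψ.normSq) (hle : ψ.energy F ≤ hi * ψ.normSq) :
    CharUpperRow F a b σ p hi :=
  charUpperRow_of_certificate hF (charUpperCertificate F ψ hsec hcl hpos hle)

end CIVec

/-! ## The one-sided class-gap bracket -/

/-- **The class gap is nonnegative**: `0 ≤ E(class) − E₀(a, b)` for an inhabited class of a symmetric model.
[cite: HelgakerJorgensenOlsen2000, eq. (4.2.38), p. 115] -/
theorem CharUpperRow.gap_nonneg (hF : F.IsSymmetric) {hi : ℚ} (hU : CharUpperRow F a b σ p hi) :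
    0 ≤ F.charEnergy a b σ p - F.energy a b := by
  obtain ⟨⟨s, ha, hb, hs⟩, -⟩ := hU
  exact sub_nonneg.2 (Model.energy_le_charEnergy hF ha hb hs)

/-- **ONE-SIDED CLASS-GAP BRACKET** (how an irrep excitation like `HC(O)O• ²B₂ − ²A₁` is certified today): a
class upper row `E(class) ≤ hi` and a plain sector lower row `lo ≤ E₀(a, b)` give
`E(class) − E₀(a, b) ≤ hi − lo`. The missing side (a lower bound on `E(class) − E₀` beyond `0`, or on
`E(class)` beyond `lo`) needs an excited-state instrument and is NOT provided here.
[cite: HelgakerJorgensenOlsen2000, eq. (4.2.38), p. 115] -/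
theorem CharUpperRow.gap_le {lo hi : ℚ} (hU : CharUpperRow F a b σ p hi) (hL : LowerRow F a b lo) :
    F.charEnergy a b σ p - F.energy a b ≤ ((hi - lo : ℚ) : ℝ) := by
  push_cast
  linarith [hU.le, hL.le]

end Summit.Ventures.CertifiedQuantumChemistry
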